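import Summits.Schanuel.Schanuel.Theorems.RootDecomp1KCommonRadixCell06

/-!
# RootDecomp1KCommonRadixCell — lens 1, generation 37 «COMMON-RADIX WALL CELL of 33364» (the dependent-base wall `(1, ℓ₂, ℓ₄)`) — continuation (RootDecomp1KCommonRadixCell07): §8 separation (`z_V` on no g34/g35/hyper cell and on no g36 injective-weight cell) and §9 CHECKLIST K-g37 names and control-side facts (`weights_not_injective_of_two_four`, `no_commonRadix_two_three`)

(lens-1 g37 `RootDecomp1KCommonRadixCell.lean`, sha256 2ee3a3e8…2418, own farm rc 0 · 0 sorry · axioms std; critic VERDICT STATUS L1748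
(credit K-R23 (β′), PORT GO LOW); port by census-1 gen 16 in seven parts `RootDecomp1KCommonRadixCell01`–`07` — see the PORT NOTE of part 01;
`--supports stmt-Schanuel-33364`; rung 0.)
-/

noncomputable section

open Complex IntermediateField Polynomial
open Summit.Schanuel.Schanuel.Theorems.RootDecomp1KHyper
open Summit.Schanuel.Schanuel.Theorems.RootDecomp1KHyper.HyperCell
open Summit.Schanuel.Schanuel.Theorems.RootDecomp1KGeneric
open Summit.Schanuel.Schanuel.Theorems.RootDecomp1KRelLiouvilleCell
open Summit.Schanuel.Schanuel.Theorems.RootDecomp1KLogLogCell (LogLogLiouville logLogLiouville_of_logSqLiouville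
  logLogLiouville_of_logHyperLiouville logLogLiouville_of_hyperLiouville)
open Summit.Schanuel.Schanuel.Theorems.RootDecomp1KTwoBaseCell (partialSum_pos' liouvilleNumber_le partialSum_lt_two numerator_lt exists_int_mul_eq_map' algebraicIndependent_of_forall_int' norm_pow_sub_pow_le' norm_prod_pow_sub_prod_pow_le norm_aeval_sub_aeval_le growth_beats lpart
  tpart lpart_apply tpart_apply eq_of_parts_eq psNumer partialSum_eq_psNumer_div coprime_psNumer liouvilleNumber_sub_rat_lower_loglog not_logLogLiouville_liouvilleNumber liouvilleNumber_three_lt_one sb_of_range_eq')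

namespace Summit.Schanuel.Schanuel.Theorems.RootDecomp1KCommonRadixCell

open LiouvilleNumber
open scoped Nat

section Cells
open LiouvilleNumber
open scoped Nat

/-- `1 < ℓ₂`. -/
private theorem one_lt_liouvilleNumber_two : 1 < liouvilleNumber 2 := by
  have h := partialSum_add_remainder (by norm_num : (1 : ℝ) < 2) 1
  have hp : partialSum 2 1 = 1 := by
    simp [partialSum, Finset.sum_range_succ]; norm_num
  have hr := remainder_pos (by norm_num : (1 : ℝ) < 2) 1
  linarith

/-! ### Separation: `z_V` lies on no previously decided cell (g34 / g35 classes, g36 injective-weight cells) -/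

/-- **`ℓ₄` (and `ℓ₂`) is BELOW every previously decided class** (hypothesis-free): not log-log-Liouville (g35's class,
tree `RootDecomp1KLogLogCell.LogLogLiouville`), hence not log-square (lens 6 g14), not log-hyper (g34), not
hyper-Liouville (the route's class) — by the tree ladder lemmas. -/
theorem zV_coordinates_below_previous_classes :
    ¬ LogLogLiouville (liouvilleNumber 4) ∧
    ¬ Summit.Schanuel.Schanuel.Theorems.RootDecomp1KGeneric.LogSqLiouville (liouvilleNumber 4) ∧
    ¬ Summit.Schanuel.Schanuel.Theorems.RootDecomp1KRelLiouvilleCell.LogHyperLiouville (liouvilleNumber 4) ∧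
    ¬ Summit.Schanuel.Schanuel.Theorems.RootDecomp1KHyper.HyperCell.HyperLiouville (liouvilleNumber 4) ∧
    ¬ LogLogLiouville (liouvilleNumber 2) := by
  have h3 : ¬ LogLogLiouville (liouvilleNumber 4) := by
    simpa using not_logLogLiouville_liouvilleNumber (by norm_num : 2 ≤ 4)
  have h2 : ¬ LogLogLiouville (liouvilleNumber 2) := by
    simpa using not_logLogLiouville_liouvilleNumber (le_refl 2)
  exact ⟨h3, fun h => h3 (logLogLiouville_of_logSqLiouville h),
    fun h => h3 (logLogLiouville_of_logHyperLiouville h), fun h => h3 (logLogLiouville_of_hyperLiouville h), h2⟩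

/-- Range bookkeeping: if `Set.range z_V = Set.range (1, ℓ₂, ρ)` then `ρ = ℓ₄`. -/
theorem eq_of_range_zV_eq {ρ : ℝ}
    (h : Set.range zV = Set.range ![(1 : ℂ), ((liouvilleNumber 2 : ℝ) : ℂ), (ρ : ℂ)]) :
    ρ = liouvilleNumber 4 := by
  have hlt := liouvilleNumber_four_lt_one
  have hgt := one_lt_liouvilleNumber_two
  have hmem : zV 2 ∈ Set.range ![(1 : ℂ), ((liouvilleNumber 2 : ℝ) : ℂ), (ρ : ℂ)] := h ▸ ⟨2, rfl⟩
  obtain ⟨j, hj⟩ := hmem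
  have e2 : zV 2 = ((liouvilleNumber 4 : ℝ) : ℂ) := rfl
  rw [e2] at hj
  fin_cases j
  · simp only [Fin.zero_eta, Matrix.cons_val_zero] at hj
    have : (1 : ℝ) = liouvilleNumber 4 := by exact_mod_cast hj
    linarith
  · simp only [Fin.mk_one, Matrix.cons_val_one, Matrix.cons_val_zero] at hj
    have : liouvilleNumber 2 = liouvilleNumber 4 := by exact_mod_cast hj
    linarith
  · simp only [Fin.reduceFinMk, Matrix.cons_val_two, Matrix.tail_cons, Matrix.head_cons] at hj
    exact_mod_cast hj

/-- Range bookkeeping, π-twin: if `Set.range z_V^π = Set.range (π, πℓ₂, πρ)` then `ρ = ℓ₄`. -/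
theorem eq_of_range_zVpi_eq {ρ : ℝ}
    (h : Set.range zVpi = Set.range ![(Real.pi : ℂ), (Real.pi : ℂ) * ((liouvilleNumber 2 : ℝ) : ℂ),
      (Real.pi : ℂ) * (ρ : ℂ)]) :
    ρ = liouvilleNumber 4 := by
  have hlt := liouvilleNumber_four_lt_one
  have hgt := one_lt_liouvilleNumber_two
  have hπ0 : (Real.pi : ℂ) ≠ 0 := by exact_mod_cast Real.pi_ne_zero
  have hmem : zVpi 2 ∈ Set.range ![(Real.pi : ℂ), (Real.pi : ℂ) * ((liouvilleNumber 2 : ℝ) : ℂ),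
      (Real.pi : ℂ) * (ρ : ℂ)] := h ▸ ⟨2, rfl⟩
  obtain ⟨j, hj⟩ := hmem
  have e2 : zVpi 2 = (Real.pi : ℂ) * ((liouvilleNumber 4 : ℝ) : ℂ) := rfl
  rw [e2] at hj
  fin_cases j
  · simp only [Fin.zero_eta, Matrix.cons_val_zero] at hj
    have h1 : (Real.pi : ℂ) * 1 = (Real.pi : ℂ) * ((liouvilleNumber 4 : ℝ) : ℂ) := by rw [mul_one]; exact hj
    have h2 := mul_left_cancel₀ hπ0 h1
    have : (1 : ℝ) = liouvilleNumber 4 := by exact_mod_cast h2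
    linarith
  · simp only [Fin.mk_one, Matrix.cons_val_one, Matrix.cons_val_zero] at hj
    have h2 := mul_left_cancel₀ hπ0 hj
    have : liouvilleNumber 2 = liouvilleNumber 4 := by exact_mod_cast h2
    linarith
  · simp only [Fin.reduceFinMk, Matrix.cons_val_two, Matrix.tail_cons, Matrix.head_cons] at hj
    have h2 := mul_left_cancel₀ hπ0 hj
    exact_mod_cast h2

/-- **`z_V` and `z_V^π` lie on NO g35 log-log cell** (and a fortiori on no g34 log-hyper cell, no hyper-Liouville cell):
the cells `Set.range z = Set.range (1, ℓ₂, ρ)` / `(π, πℓ₂, πρ)` with `ρ` log-log-Liouville miss them. Hypothesis-free. -/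
theorem zV_outside_logLogCells :
    (¬ ∃ ρ : ℝ, LogLogLiouville ρ ∧
        Set.range zV = Set.range ![(1 : ℂ), ((liouvilleNumber 2 : ℝ) : ℂ), (ρ : ℂ)]) ∧
    (¬ ∃ ρ : ℝ, LogLogLiouville ρ ∧
        Set.range zVpi = Set.range ![(Real.pi : ℂ), (Real.pi : ℂ) * ((liouvilleNumber 2 : ℝ) : ℂ),
          (Real.pi : ℂ) * (ρ : ℂ)]) := by
  have h3 := zV_coordinates_below_previous_classes.1
  refine ⟨?_, ?_⟩
  · rintro ⟨ρ, hρ, hr⟩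
    rw [eq_of_range_zV_eq hr] at hρ
    exact h3 hρ
  · rintro ⟨ρ, hρ, hr⟩
    rw [eq_of_range_zVpi_eq hr] at hρ
    exact h3 hρ

/-- The weights of a base vector containing `2` and `4` at distinct places are not injective (`2² = 4¹`). -/
theorem weights_not_injective_of_two_four {k : ℕ} {b : Fin k → ℕ} {i j : Fin k} (hij : i ≠ j)
    (hi : b i = 4) (hj : b j = 2) :
    ¬ Function.Injective (fun m : Fin k →₀ ℕ => ∏ l, b l ^ m l) := by
  classical
  intro hinj
  have hwt : ∀ (l₀ : Fin k) (c : ℕ), (∏ l, b l ^ (Finsupp.single l₀ c) l) = b l₀ ^ c := by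
    intro l₀ c
    rw [Finset.prod_eq_single l₀]
    · rw [Finsupp.single_eq_same]
    · intro l _ hne
      rw [Finsupp.single_apply, if_neg hne.symm, pow_zero]
    · intro h; exact absurd (Finset.mem_univ _) h
  have h1 : (fun m : Fin k →₀ ℕ => ∏ l, b l ^ m l) (Finsupp.single j 2) =
      (fun m : Fin k →₀ ℕ => ∏ l, b l ^ m l) (Finsupp.single i 1) := by
    simp only
    rw [hwt, hwt, hi, hj]
    norm_num
  have h2 := Finsupp.ext_iff.mp (hinj h1) j
  rw [Finsupp.single_eq_same, Finsupp.single_apply, if_neg hij] at h2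
  exact absurd h2 (by norm_num)

/-- **`z_V` lies on NO g36 multi-base cell** `Set.range z = Set.range (1, ℓ_{b_1}, …, ℓ_{b_k})` with INJECTIVE weights
(bases `b_i ≥ 2`): the range equality forces `2, 4 ∈ {b_i}` (injectivity of `b ↦ ℓ_b`, `ℓ₄ < 1 < ℓ₂ ≠ 1`), and then
the weights collide. Hypothesis-free. -/
theorem zV_outside_injectiveWeightCells :
    ¬ ∃ (k : ℕ) (b : Fin k → ℕ), (∀ i, 2 ≤ b i) ∧
      Function.Injective (fun m : Fin k →₀ ℕ => ∏ l, b l ^ m l) ∧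
      Set.range zV = Set.range (Fin.cons (1 : ℂ) (fun i => ((liouvilleNumber (b i) : ℝ) : ℂ))) := by
  rintro ⟨k, b, hb, hinj, hrange⟩
  have hlt := liouvilleNumber_four_lt_one
  have hgt := one_lt_liouvilleNumber_two
  -- `ℓ₂ = ℓ_{b j}` and `ℓ₄ = ℓ_{b i}` for some `i, j`
  have hmem : ∀ t : Fin 3,
      zV t ∈ Set.range (Fin.cons (1 : ℂ) (fun i => ((liouvilleNumber (b i) : ℝ) : ℂ)) : Fin (k + 1) → ℂ) :=
    fun t => hrange ▸ Set.mem_range_self t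
  have key : ∀ (c : ℕ), 2 ≤ c → liouvilleNumber (c : ℝ) ≠ 1 →
      ((liouvilleNumber (c : ℝ) : ℝ) : ℂ) ∈
        Set.range (Fin.cons (1 : ℂ) (fun i => ((liouvilleNumber (b i) : ℝ) : ℂ)) : Fin (k + 1) → ℂ) →
      ∃ i, b i = c := by
    intro c hc hc1 hm
    obtain ⟨x, hx⟩ := Set.mem_range.mp hm
    refine Fin.cases ?_ (fun i hi => ?_) x hx
    · intro h0
      simp only [Fin.cons_zero] at h0
      exact absurd (by exact_mod_cast h0.symm) hc1
    · simp only [Fin.cons_succ] at hi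
      exact ⟨i, liouvilleNumber_base_injective (hb i) hc (by exact_mod_cast hi)⟩
  obtain ⟨j, hj⟩ := key 2 (le_refl 2) (by simpa using hgt.ne') (by simpa [zV] using hmem 1)
  obtain ⟨i, hi⟩ := key 4 (by norm_num) (by simpa using hlt.ne) (by simpa [zV] using hmem 2)
  have hij : i ≠ j := by rintro rfl; omega
  exact weights_not_injective_of_two_four hij hi hj hinj

/-- The same for the π-twin against the g36 π-cells `Set.range z = Set.range (π, πℓ_{b_1}, …, πℓ_{b_k})`. -/
theorem zVpi_outside_injectiveWeightCells :
    ¬ ∃ (k : ℕ) (b : Fin k → ℕ), (∀ i, 2 ≤ b i) ∧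
      Function.Injective (fun m : Fin k →₀ ℕ => ∏ l, b l ^ m l) ∧
      Set.range zVpi = Set.range (Fin.cons (Real.pi : ℂ)
        (fun i => (Real.pi : ℂ) * ((liouvilleNumber (b i) : ℝ) : ℂ))) := by
  rintro ⟨k, b, hb, hinj, hrange⟩
  have hlt := liouvilleNumber_four_lt_one
  have hgt := one_lt_liouvilleNumber_two
  have hπ0 : (Real.pi : ℂ) ≠ 0 := by exact_mod_cast Real.pi_ne_zero
  have hmem : ∀ t : Fin 3,
      zVpi t ∈ Set.range (Fin.cons (Real.pi : ℂ)
        (fun i => (Real.pi : ℂ) * ((liouvilleNumber (b i) : ℝ) : ℂ)) : Fin (k + 1) → ℂ) :=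
    fun t => hrange ▸ Set.mem_range_self t
  have key : ∀ (c : ℕ), 2 ≤ c → liouvilleNumber (c : ℝ) ≠ 1 →
      (Real.pi : ℂ) * ((liouvilleNumber (c : ℝ) : ℝ) : ℂ) ∈
        Set.range (Fin.cons (Real.pi : ℂ)
          (fun i => (Real.pi : ℂ) * ((liouvilleNumber (b i) : ℝ) : ℂ)) : Fin (k + 1) → ℂ) →
      ∃ i, b i = c := by
    intro c hc hc1 hm
    obtain ⟨x, hx⟩ := Set.mem_range.mp hm
    refine Fin.cases ?_ (fun i hi => ?_) x hx
    · intro h0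
      simp only [Fin.cons_zero] at h0
      have h1 : (Real.pi : ℂ) * 1 = (Real.pi : ℂ) * ((liouvilleNumber (c : ℝ) : ℝ) : ℂ) := by
        rw [mul_one]; exact h0
      have h2 := mul_left_cancel₀ hπ0 h1
      exact absurd (by exact_mod_cast h2.symm) hc1
    · simp only [Fin.cons_succ] at hi
      have h2 := mul_left_cancel₀ hπ0 hi
      exact ⟨i, liouvilleNumber_base_injective (hb i) hc (by exact_mod_cast h2)⟩
  obtain ⟨j, hj⟩ := key 2 (le_refl 2) (by simpa using hgt.ne') (by simpa [zVpi] using hmem 1)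
  obtain ⟨i, hi⟩ := key 4 (by norm_num) (by simpa using hlt.ne) (by simpa [zVpi] using hmem 2)
  have hij : i ≠ j := by rintro rfl; omega
  exact weights_not_injective_of_two_four hij hi hj hinj

end Cells

/-! ## §9  CHECKLIST names, explicit separation from the g34 / g35 / hyper cells, and control-side facts -/

section Checklist
open LiouvilleNumber
open scoped Nat

/-- **(CR) under the CHECKLIST K-g37 name**: the common-radix Liouville block `(ℓ_{β^{a_1}}, …, ℓ_{β^{a_k}})` is
algebraically independent over `ℚ` — HYPOTHESIS-FREE (`β ≥ 2`, `a` injective, `a_i ≥ 1`). -/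
theorem algebraicIndependent_liouvilleNumber_commonRadix {k β : ℕ} (hβ : 2 ≤ β) {a : Fin k → ℕ}
    (ha : Function.Injective a) (ha1 : ∀ i, 1 ≤ a i) :
    AlgebraicIndependent ℚ (fun i => ((liouvilleNumber ((β ^ a i : ℕ) : ℝ) : ℝ) : ℂ)) :=
  algebraicIndependent_liouville_commonRadix hβ ha ha1

/-- **(X″) under the CHECKLIST K-g37 name**: `MvPolyMeasure θ⃗` + `AlgebraicIndependent ℚ ℓ_b` ⇒
`AlgebraicIndependent ℚ (ℓ_b, θ⃗)` for ANY bases `b_i ≥ 2`. -/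
theorem algebraicIndependent_append_of_block {k n : ℕ} {b : Fin k → ℕ} {θ : Fin n → ℂ}
    (hθ : Summit.Schanuel.Schanuel.Theorems.RootDecomp1KHyper.MvPolyMeasure θ) (hb : ∀ i, 2 ≤ b i)
    (hAI : AlgebraicIndependent ℚ (fun i => ((liouvilleNumber (b i) : ℝ) : ℂ))) :
    AlgebraicIndependent ℚ (Fin.append (fun i => ((liouvilleNumber (b i) : ℝ) : ℂ)) θ) :=
  algebraicIndependent_append_of_algebraicIndependent hθ hb hAI

/-- **(CR-dom) in `∀ N ≥ N₀` form** (the all-order dominance / non-vanishing lemma, any degree, no minimality). -/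
theorem commonRadix_eval_ne_zero_eventually {k β : ℕ} (hβ : 2 ≤ β) {a : Fin k → ℕ}
    (ha : Function.Injective a) (ha1 : ∀ i, 1 ≤ a i) (q : MvPolynomial (Fin k) ℝ) (hq : q ≠ 0) :
    ∃ N₀ : ℕ, ∀ N ≥ N₀, MvPolynomial.eval (fun i => partialSum ((β ^ a i : ℕ) : ℝ) N) q ≠ 0 := by
  obtain ⟨N₀, h⟩ := eventually_eval_partialSum_ne_zero_commonRadix hβ ha ha1 hq
  exact ⟨N₀, fun N hN => h N hN⟩

/-- **`z_V`, `z_V^π` lie on NO g34 (log-hyper), NO lens-6 g14 (log-square), NO hyper-Liouville cell** over `(1, ℓ₂)` /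
`(π, πℓ₂)` — explicit form of the ladder consequence of `zV_outside_logLogCells` (tree classes BY FQ NAME). -/
theorem zV_outside_previous_relative_cells :
    (¬ ∃ ρ : ℝ, Summit.Schanuel.Schanuel.Theorems.RootDecomp1KRelLiouvilleCell.LogHyperLiouville ρ ∧
        Set.range zV = Set.range ![(1 : ℂ), ((liouvilleNumber 2 : ℝ) : ℂ), (ρ : ℂ)]) ∧
    (¬ ∃ ρ : ℝ, Summit.Schanuel.Schanuel.Theorems.RootDecomp1KGeneric.LogSqLiouville ρ ∧
        Set.range zV = Set.range ![(1 : ℂ), ((liouvilleNumber 2 : ℝ) : ℂ), (ρ : ℂ)]) ∧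
    (¬ ∃ ρ : ℝ, Summit.Schanuel.Schanuel.Theorems.RootDecomp1KHyper.HyperCell.HyperLiouville ρ ∧
        Set.range zV = Set.range ![(1 : ℂ), ((liouvilleNumber 2 : ℝ) : ℂ), (ρ : ℂ)]) ∧
    (¬ ∃ ρ : ℝ, Summit.Schanuel.Schanuel.Theorems.RootDecomp1KRelLiouvilleCell.LogHyperLiouville ρ ∧
        Set.range zVpi = Set.range ![(Real.pi : ℂ), (Real.pi : ℂ) * ((liouvilleNumber 2 : ℝ) : ℂ),
          (Real.pi : ℂ) * (ρ : ℂ)]) ∧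
    (¬ ∃ ρ : ℝ, Summit.Schanuel.Schanuel.Theorems.RootDecomp1KGeneric.LogSqLiouville ρ ∧
        Set.range zVpi = Set.range ![(Real.pi : ℂ), (Real.pi : ℂ) * ((liouvilleNumber 2 : ℝ) : ℂ),
          (Real.pi : ℂ) * (ρ : ℂ)]) ∧
    (¬ ∃ ρ : ℝ, Summit.Schanuel.Schanuel.Theorems.RootDecomp1KHyper.HyperCell.HyperLiouville ρ ∧
        Set.range zVpi = Set.range ![(Real.pi : ℂ), (Real.pi : ℂ) * ((liouvilleNumber 2 : ℝ) : ℂ),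
          (Real.pi : ℂ) * (ρ : ℂ)]) := by
  obtain ⟨h1, h2⟩ := zV_outside_logLogCells
  exact ⟨fun ⟨ρ, hρ, hr⟩ => h1 ⟨ρ, logLogLiouville_of_logHyperLiouville hρ, hr⟩,
    fun ⟨ρ, hρ, hr⟩ => h1 ⟨ρ, logLogLiouville_of_logSqLiouville hρ, hr⟩,
    fun ⟨ρ, hρ, hr⟩ => h1 ⟨ρ, logLogLiouville_of_hyperLiouville hρ, hr⟩,
    fun ⟨ρ, hρ, hr⟩ => h2 ⟨ρ, logLogLiouville_of_logHyperLiouville hρ, hr⟩,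
    fun ⟨ρ, hρ, hr⟩ => h2 ⟨ρ, logLogLiouville_of_logSqLiouville hρ, hr⟩,
    fun ⟨ρ, hρ, hr⟩ => h2 ⟨ρ, logLogLiouville_of_hyperLiouville hρ, hr⟩⟩

/-- Control-side fact: the exponent vector `(1, 1)` is NOT injective (so `(ℓ₂, ℓ₂)` is no common-radix cell). -/
theorem a11_not_injective : ¬ Function.Injective (![1, 1] : Fin 2 → ℕ) := by decide

/-- Control-side fact: the g36 bases `(2, 3)` have NO common radix — `2 = β^{a₀}`, `3 = β^{a₁}` with `β ≥ 2` is
impossible (then `β ∣ gcd(2, 3) = 1`). So the common-radix theorem cannot be FED `(2, 3)`; those bases are g36's. -/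
theorem no_commonRadix_two_three :
    ¬ ∃ (β : ℕ) (a : Fin 2 → ℕ), 2 ≤ β ∧ (2 : ℕ) = β ^ a 0 ∧ (3 : ℕ) = β ^ a 1 := by
  rintro ⟨β, a, hβ, h2, h3⟩
  have ha0 : a 0 ≠ 0 := by intro h; rw [h, pow_zero] at h2; omega
  have ha1 : a 1 ≠ 0 := by intro h; rw [h, pow_zero] at h3; omega
  have e0 : β ^ a 0 = β * β ^ (a 0 - 1) := by
    rw [← pow_succ', Nat.sub_add_cancel (Nat.one_le_iff_ne_zero.mpr ha0)]
  have e1 : β ^ a 1 = β * β ^ (a 1 - 1) := by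
    rw [← pow_succ', Nat.sub_add_cancel (Nat.one_le_iff_ne_zero.mpr ha1)]
  have d2 : β ∣ 2 := ⟨β ^ (a 0 - 1), by rw [← e0]; exact h2⟩
  have d3 : β ∣ 3 := ⟨β ^ (a 1 - 1), by rw [← e1]; exact h3⟩
  have d1 : β ∣ Nat.gcd 2 3 := Nat.dvd_gcd d2 d3
  have e : Nat.gcd 2 3 = 1 := by decide
  rw [e] at d1
  have := Nat.le_of_dvd one_pos d1
  omega

/-- Control-side fact: conversely the wall bases `(2, 4)` DO have the common radix `β = 2`, `a = (1, 2)`. -/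
theorem commonRadix_two_four : (![2, 4] : Fin 2 → ℕ) = fun i => 2 ^ a12 i := by
  funext i; fin_cases i <;> simp [a12]

end Checklist

end Summit.Schanuel.Schanuel.Theorems.RootDecomp1KCommonRadixCell

end
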